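import Literature.NumberTheory.NumberFields.RayClassFieldAdicCharacterLocalUnits
import Literature.NumberTheory.GaloisRepresentations.LocalWeilDatumValuation
import Mathlib.NumberTheory.Padics.RingHoms
import HarnessLib

/-!
# A place `v` with `𝒪_v ≅ ℤ_p`: the local field `K_v` has residue cardinality `p` and `p` is a uniformizer
# (the hypotheses `hq : residueFieldCard K_v = p`, `h2 : (p : K_v)` a uniformizer of the Lubin–Tate / Coleman files, from `e : 𝒪_v ≃+* ℤ_p` alone)

Topic `NumberTheory/NumberFields`; proof file (two theorems + one unfolding: no definition, no named fact, no instance).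
De Shalit (1987, II.1.1 p. 32, II.4.11–4.12 p. 65–69) works at a prime `𝔭` of the imaginary quadratic `K` SPLIT over `p`, where
«`𝒪_𝔭 = ℤ_p`»; the tree's one-`𝔓` assembly of II.4.12 (`Summit…PrintCf2RubinValueTwoEllipticUnitsLocalMeasure`, cf2c-w4 g10) and the
whole `PAdicOneVariable*` package are stated over the LOCAL field `F = K_v` with the two hypotheses
`hq : residueFieldCard F = 2` and `h2 : (valuation F).IsUniformizer (2 : F)` next to the ring isomorphism `e₂ : 𝒪_v ≃+* ℤ_2` that reads
the character `κ_v` in `ℤ_2`.  THIS file shows the two hypotheses FOLLOW from `e₂` (for any prime `p`):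

* `integerEquivPadicInt e := (integerEquivAdicCompletionIntegers v).trans e : 𝒪[K_v] ≃+* ℤ_[p]` is only an abbreviation inside proofs;
* ★ `residueFieldCard_adicCompletion_of_padicIntEquiv` — **`residueFieldCard K_v = p`** (`𝓀[K_v] ≅ 𝓀(ℤ_p) = 𝔽_p` along `e`);
* ★ `isUniformizer_natCast_adicCompletion_of_padicIntEquiv` — **`(p : K_v)` is a uniformizer** (`p ∈ ℤ_p` is irreducible, transported
  along `e`; irreducibles of `𝒪_F` are uniformizers, `LocalWeilDatum.valuation_eq_unifValue_of_irreducible`) — the `ℚ_p` case is the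
  tree's `Padic.isUniformizer_natCast`.

## References
* [deShalit1987] E. de Shalit, *Iwasawa theory of elliptic curves with complex multiplication* (1987), II.1.1 (p. 32), I.3.3 (p. 17).
* [NeukirchANT1999] J. Neukirch, *Algebraic Number Theory* (1999), Ch. II §4 Prop. (4.3), §5 Prop. (5.3).
* [SerreLocalFields1979] J.-P. Serre, *Local Fields* (1979), Ch. II §1 (uniformizers = irreducibles of a DVR).
-/

noncomputable section

open NumberField IsDedekindDomain IsDedekindDomain.HeightOneSpectrum Field
open scoped nonZeroDivisors Classical ValuativeRel

namespace Literature.NumberTheory.NumberFields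

open Literature.NumberTheory.GaloisRepresentations
open Literature.NumberTheory.GaloisRepresentations.IsNonarchimedeanLocalField

variable {K : Type} [Field K] [NumberField K] (v : HeightOneSpectrum (𝓞 K)) {p : ℕ} [hp : Fact p.Prime]

/-- `(p : 𝒪[K_v])` is the pull-back of `p ∈ ℤ_p` along `𝒪[K_v] ≅ 𝒪_v ≅ ℤ_p`. [cite: NeukirchANT1999, Ch. II §4 Prop. (4.3)] -/
theorem natCast_eq_symm_trans_symm_natCast (e : v.adicCompletionIntegers K ≃+* ℤ_[p]) :
    ((p : ℕ) : 𝒪[v.adicCompletion K]) =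
      (integerEquivAdicCompletionIntegers v).symm (e.symm ((p : ℕ) : ℤ_[p])) := by
  rw [map_natCast, map_natCast]

/-- ★ **`residueFieldCard K_v = p` when `𝒪_v ≅ ℤ_p`** (de Shalit's «`𝒪_𝔭 = ℤ_p`» at a split prime): the residue field of the
valuative integer ring `𝒪[K_v]` is that of `ℤ_p`, i.e. `𝔽_p`, along `e ∘ (𝒪[K_v] ≅ 𝒪_v)` — the hypothesis `hq` of the
Lubin–Tate / Coleman package at `F = K_v`. [cite: deShalit1987, II.1.1 (p. 32)] [cite: NeukirchANT1999, Ch. II §4 Prop. (4.3)] -/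
theorem residueFieldCard_adicCompletion_of_padicIntEquiv (e : v.adicCompletionIntegers K ≃+* ℤ_[p]) :
    residueFieldCard (v.adicCompletion K) = p := by
  rw [residueFieldCard]
  have φ : 𝓀[v.adicCompletion K] ≃+* ZMod p :=
    (IsLocalRing.ResidueField.mapEquiv ((integerEquivAdicCompletionIntegers v).trans e)).trans PadicInt.residueField
  rw [Nat.card_congr φ.toEquiv, Nat.card_zmod]

/-- ★ **`(p : K_v)` is a uniformizer when `𝒪_v ≅ ℤ_p`**: `p ∈ ℤ_p` is irreducible (`PadicInt.irreducible_p`), so is its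
pull-back `(p : 𝒪[K_v])`, and irreducibles of the valuation ring of a local field are uniformizers — the hypothesis `h2`
(`hπ` with `π = p`, before twisting by a unit `u`) of the Lubin–Tate / Coleman package at `F = K_v`; the case `F = ℚ_p` is
`Padic.isUniformizer_natCast`. [cite: deShalit1987, I.3.3 (p. 17), II.1.1 (p. 32)] [cite: SerreLocalFields1979, Ch. II §1] -/
theorem isUniformizer_natCast_adicCompletion_of_padicIntEquiv (e : v.adicCompletionIntegers K ≃+* ℤ_[p]) :
    (ValuativeRel.valuation (v.adicCompletion K)).IsUniformizer ((((p : ℕ) : 𝒪[v.adicCompletion K]) : v.adicCompletion K)) := by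
  rw [isUniformizer_iff_valuation_eq_unifValue]
  apply LocalWeilDatum.valuation_eq_unifValue_of_irreducible
  rw [natCast_eq_symm_trans_symm_natCast v e]
  exact (MulEquiv.irreducible_iff (integerEquivAdicCompletionIntegers v).symm.toMulEquiv).mpr
    ((MulEquiv.irreducible_iff e.symm.toMulEquiv).mpr PadicInt.irreducible_p)

end Literature.NumberTheory.NumberFields

end
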